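import Mathlib.Geometry.Manifold.Instances.Sphere
import Mathlib.Analysis.SpecialFunctions.Complex.Circle
import Mathlib.Geometry.Manifold.ContMDiff.Atlas
import Mathlib.Geometry.Manifold.ContMDiff.NormedSpace
import Mathlib.Geometry.Manifold.MFDeriv.NormedSpace
import Mathlib.Geometry.Manifold.ContMDiffMFDeriv
import Mathlib.Analysis.Calculus.BumpFunction.InnerProduct
import Literature.Analysis.FunctionSpaces.OrbitMeanZeroPrimitive
import HarnessLib

/-!
# Averaging a function over a smooth circle action; the orbitwise mean-zero primitive

General differential topology (topic `Geometry/Manifold`), written for the fact seat of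
`Literature.Geometry.Symplectic.mclean_divisorComplement_convex_four` (M. McLean, *The growth
rate of symplectic homology and affine varieties*, GAFA 22 (2012), proof of Lemma 5.17: the
fibrewise correction `f''` making `θ + df''` rotation-normalised near the divisor; McDuff–Salamon
2017, §5.5, averaging over a circle action).  A smooth circle action on a manifold `M`
(model `𝓡 k`) is given, as in `Literature/Geometry/Manifold/FreeCircleAction.lean`, by
`θ : Circle → M → M` with `θ (a * b) = θ a ∘ θ b`, jointly `C^∞`.  For a `C^∞` function
`g : M → ℝ` put (both written out explicitly in the statements, no definitions)

* `A(x) = (2π)⁻¹ ∫₀^{2π} g(θ(e^{iσ}) x) dσ` — the **orbit average**;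
* `h(x) = -(2π)⁻¹ ∫₀^{2π} (∫₀^τ g(θ(e^{iσ}) x) dσ - τ A(x)) dτ` — the value at `x` of the
  **mean-zero primitive of `g - A` along the orbit of `x`**.

Results:
* `hasDerivAt_orbitMeanZero` — `d/ds h(θ(e^{is}) x) = g(θ(e^{is}) x) - A(x)`: **`h` solves
  `X·h = g - A` along the orbits** (`X` the fundamental vector field), by the shift covariance of
  mean-zero primitives (`Literature.Analysis.FunctionSpaces.hasDerivAt_meanZeroValue_comp_add`);
* `orbitAverage_act` — `A` is invariant under the action;
* `contDiff_orbitIntegrand_chart` — in a chart at `x₀`, cut off by a bump function, the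
  integrand `(σ, p) ↦ ψ(p) g(θ(e^{iσ})(e⁻¹ p))` is `C^∞` on `ℝ × ℝᵏ`;
* `contMDiff_orbitAverage`, `contMDiff_orbitMeanZero` — **`A` and `h` are `C^∞` on `M`**
  (parametric integrals in charts: `contDiff_average_param`, `contDiff_meanZeroValue_param`);
* `mfderiv_orbitMeanZero_fundamental` — **`dh(X) = g - A`** for the fundamental vector field
  `X(x) = d/dt|₀ θ(e^{it}) x`.

Everything is proved; no definitions, no named facts (D-0026).

## References

* D. McDuff, D. Salamon, *Introduction to Symplectic Topology*, 3rd ed. (2017), §5.5 (averaging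
  over a compact group action). [McDuffSalamon2017]
* M. McLean, *The growth rate of symplectic homology and affine varieties*, Geom. Funct. Anal. 22
  (2012), proof of Lemma 5.17. [Mclean2012]
-/

noncomputable section

open scoped Manifold ContDiff Topology Real
open Set Function Filter MeasureTheory intervalIntegral
open Literature.Analysis.FunctionSpaces

namespace Literature.Geometry.Manifold

variable {k : ℕ} {M : Type*} [TopologicalSpace M] [ChartedSpace (EuclideanSpace ℝ (Fin k)) M]
  {θ : Circle → M → M} {g : M → ℝ}

/-! ### Along one orbit -/

omit [ChartedSpace (EuclideanSpace ℝ (Fin k)) M] in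
/-- The function read along an orbit, `σ ↦ g (θ (exp σ) x)`, is continuous. [folklore] -/
theorem continuous_orbitFunction (hθc : Continuous fun p : Circle × M ↦ θ p.1 p.2)
    (hgc : Continuous g) (x : M) : Continuous fun σ : ℝ ↦ g (θ (Circle.exp σ) x) :=
  hgc.comp (hθc.comp (Circle.exp.continuous.prodMk continuous_const))

omit [TopologicalSpace M] [ChartedSpace (EuclideanSpace ℝ (Fin k)) M] in
/-- The function read along an orbit is `2π`-periodic. [folklore] -/
theorem periodic_orbitFunction (x : M) :
    Function.Periodic (fun σ : ℝ ↦ g (θ (Circle.exp σ) x)) (2 * π) := fun σ ↦ by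
  simp only [Circle.periodic_exp σ]

omit [TopologicalSpace M] [ChartedSpace (EuclideanSpace ℝ (Fin k)) M] in
/-- Reading along the orbit of `θ (exp s) x` shifts the parameter: the flow property.
[folklore] -/
theorem orbitFunction_act (hmul : ∀ a b x, θ (a * b) x = θ a (θ b x)) (x : M) (s σ : ℝ) :
    g (θ (Circle.exp σ) (θ (Circle.exp s) x)) = g (θ (Circle.exp (σ + s)) x) := by
  rw [Circle.exp_add, hmul]

omit [TopologicalSpace M] [ChartedSpace (EuclideanSpace ℝ (Fin k)) M] in
/-- **The orbit average is invariant under the action.** [folklore] -/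
theorem orbitAverage_act (hmul : ∀ a b x, θ (a * b) x = θ a (θ b x)) (x : M) (s : ℝ) :
    (2 * π)⁻¹ * ∫ σ in (0 : ℝ)..2 * π, g (θ (Circle.exp σ) (θ (Circle.exp s) x)) =
      (2 * π)⁻¹ * ∫ σ in (0 : ℝ)..2 * π, g (θ (Circle.exp σ) x) := by
  simp only [orbitFunction_act hmul]
  rw [intervalIntegral_comp_add_period (periodic_orbitFunction x) s]

omit [ChartedSpace (EuclideanSpace ℝ (Fin k)) M] in
/-- **The orbitwise mean-zero primitive solves `X·h = g - A` along the orbits**: with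
`A(x) = (2π)⁻¹ ∫₀^{2π} g(θ(e^{iσ})x) dσ` and
`h(x) = -(2π)⁻¹ ∫₀^{2π} (∫₀^τ g(θ(e^{iσ})x) dσ - τ A(x)) dτ`,
`d/ds h(θ(e^{is}) x) = g(θ(e^{is}) x) - A(x)` (McDuff–Salamon 2017, §5.5; McLean 2012, proof of
Lemma 5.17). [cite: McDuffSalamon2017, §5.5 (averaging over a circle action)] -/
theorem hasDerivAt_orbitMeanZero (hθc : Continuous fun p : Circle × M ↦ θ p.1 p.2)
    (hmul : ∀ a b x, θ (a * b) x = θ a (θ b x)) (hgc : Continuous g) (x : M) (s : ℝ) :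
    HasDerivAt (fun s : ℝ ↦ -((2 * π)⁻¹ * ∫ τ in (0 : ℝ)..2 * π,
        ((∫ σ in (0 : ℝ)..τ, g (θ (Circle.exp σ) (θ (Circle.exp s) x))) -
          τ * ((2 * π)⁻¹ * ∫ σ in (0 : ℝ)..2 * π, g (θ (Circle.exp σ) (θ (Circle.exp s) x))))))
      (g (θ (Circle.exp s) x) - (2 * π)⁻¹ * ∫ σ in (0 : ℝ)..2 * π, g (θ (Circle.exp σ) x)) s := by
  simp only [orbitFunction_act hmul]
  exact hasDerivAt_meanZeroValue_comp_add (continuous_orbitFunction hθc hgc x)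
    (by positivity) (periodic_orbitFunction x) s

/-! ### Smoothness: the integrand in a chart -/

section Chart

variable [IsManifold (𝓡 k) ∞ M]

/-- **The orbit integrand in a chart, cut off, is jointly smooth**: for the extended chart `e`
at `x₀` and a bump function `ψ` with `tsupport ψ ⊆ e.target`, the function
`(σ, p) ↦ ψ(p) · g(θ(e^{iσ})(e⁻¹ p))` is `C^∞` on `ℝ × ℝᵏ`. [folklore] -/
theorem contDiff_orbitIntegrand_chart
    (hθ : ContMDiff ((𝓡 1).prod (𝓡 k)) (𝓡 k) ∞ (fun p : Circle × M ↦ θ p.1 p.2))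
    (hg : ContMDiff (𝓡 k) 𝓘(ℝ, ℝ) ∞ g) (x₀ : M) {ψ : EuclideanSpace ℝ (Fin k) → ℝ}
    (hψ : ContDiff ℝ ∞ ψ) (hψt : tsupport ψ ⊆ (extChartAt (𝓡 k) x₀).target) :
    ContDiff ℝ ∞ fun q : ℝ × EuclideanSpace ℝ (Fin k) ↦
      ψ q.2 * g (θ (Circle.exp q.1) ((extChartAt (𝓡 k) x₀).symm q.2)) := by
  rw [contDiff_iff_contDiffAt]
  rintro ⟨σ, p⟩
  by_cases hp : p ∈ (extChartAt (𝓡 k) x₀).target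
  · -- on the chart target the composite is smooth
    have h1 : ContMDiffAt 𝓘(ℝ, EuclideanSpace ℝ (Fin k)) (𝓡 k) ∞ (extChartAt (𝓡 k) x₀).symm p :=
      (contMDiffOn_extChartAt_symm x₀).contMDiffAt ((isOpen_extChartAt_target x₀).mem_nhds hp)
    have h2 : ContMDiffAt (𝓘(ℝ, ℝ).prod 𝓘(ℝ, EuclideanSpace ℝ (Fin k))) ((𝓡 1).prod (𝓡 k)) ∞
        (fun q : ℝ × EuclideanSpace ℝ (Fin k) ↦
          (Circle.exp q.1, (extChartAt (𝓡 k) x₀).symm q.2)) (σ, p) :=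
      ((contMDiff_circleExp (m := ∞)).contMDiffAt.comp (σ, p) contMDiffAt_fst).prodMk
        (h1.comp (σ, p) contMDiffAt_snd)
    have h3 : ContMDiffAt (𝓘(ℝ, ℝ).prod 𝓘(ℝ, EuclideanSpace ℝ (Fin k))) 𝓘(ℝ, ℝ) ∞
        (fun q : ℝ × EuclideanSpace ℝ (Fin k) ↦
          g (θ (Circle.exp q.1) ((extChartAt (𝓡 k) x₀).symm q.2))) (σ, p) :=
      hg.contMDiffAt.comp (σ, p) (hθ.contMDiffAt.comp (σ, p) h2)
    have h4 : ContMDiffAt 𝓘(ℝ, ℝ × EuclideanSpace ℝ (Fin k)) 𝓘(ℝ, ℝ) ∞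
        (fun q : ℝ × EuclideanSpace ℝ (Fin k) ↦
          g (θ (Circle.exp q.1) ((extChartAt (𝓡 k) x₀).symm q.2))) (σ, p) := by
      rw [modelWithCornersSelf_prod, ← chartedSpaceSelf_prod]; exact h3
    exact (hψ.contDiffAt.comp (σ, p) contDiffAt_snd).mul (contMDiffAt_iff_contDiffAt.1 h4)
  · -- off the target the cut-off vanishes near `p`
    have hp' : p ∉ tsupport ψ := fun h ↦ hp (hψt h)
    have hzero : ψ =ᶠ[𝓝 p] 0 := by
      rw [← notMem_tsupport_iff_eventuallyEq] ; exact hp'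
    have hev : (fun q : ℝ × EuclideanSpace ℝ (Fin k) ↦
        ψ q.2 * g (θ (Circle.exp q.1) ((extChartAt (𝓡 k) x₀).symm q.2))) =ᶠ[𝓝 (σ, p)]
        fun _ ↦ 0 := by
      have h := (continuousAt_snd (p := (σ, p))).eventually hzero
      filter_upwards [h] with q hq
      simp only [Pi.zero_apply] at hq
      simp [hq]
    exact (contDiffAt_const (c := (0 : ℝ))).congr_of_eventuallyEq hev

omit [IsManifold (𝓡 k) ∞ M] in
/-- A bump function around the chart point with support inside the chart target and equal to
`1` near the chart point. [folklore] -/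
theorem exists_bump_chart (x₀ : M) :
    ∃ ψ : EuclideanSpace ℝ (Fin k) → ℝ, ContDiff ℝ ∞ ψ ∧
      tsupport ψ ⊆ (extChartAt (𝓡 k) x₀).target ∧ ψ =ᶠ[𝓝 (extChartAt (𝓡 k) x₀ x₀)] 1 := by
  obtain ⟨ε, hε, hball⟩ := Metric.isOpen_iff.1 (isOpen_extChartAt_target (I := 𝓡 k) x₀) _
    (mem_extChartAt_target (I := 𝓡 k) x₀)
  let f : ContDiffBump (extChartAt (𝓡 k) x₀ x₀) :=
    { rIn := ε / 4
      rOut := ε / 2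
      rIn_pos := by positivity
      rIn_lt_rOut := by linarith }
  refine ⟨f, f.contDiff, ?_, f.eventuallyEq_one⟩
  rw [f.tsupport_eq]
  exact (Metric.closedBall_subset_ball (by show ε / 2 < ε; linarith)).trans hball

end Chart

/-! ### Smoothness of the orbit average and of the orbitwise mean-zero primitive -/

section Smooth

variable [IsManifold (𝓡 k) ∞ M]

/-- **The orbit average of a smooth function over a smooth circle action is smooth**
(McDuff–Salamon 2017, §5.5). [cite: McDuffSalamon2017, §5.5 (averaging over a circle action)] -/
theorem contMDiff_orbitAverage
    (hθ : ContMDiff ((𝓡 1).prod (𝓡 k)) (𝓡 k) ∞ (fun p : Circle × M ↦ θ p.1 p.2))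
    (hg : ContMDiff (𝓡 k) 𝓘(ℝ, ℝ) ∞ g) :
    ContMDiff (𝓡 k) 𝓘(ℝ, ℝ) ∞ fun x : M ↦
      (2 * π)⁻¹ * ∫ σ in (0 : ℝ)..2 * π, g (θ (Circle.exp σ) x) := by
  intro x₀
  obtain ⟨ψ, hψ, hψt, hψ1⟩ := exists_bump_chart (k := k) x₀
  set e := extChartAt (𝓡 k) x₀ with he
  set Γ : ℝ × EuclideanSpace ℝ (Fin k) → ℝ :=
    fun q ↦ ψ q.2 * g (θ (Circle.exp q.1) (e.symm q.2)) with hΓ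
  have hΓs : ContDiff ℝ ∞ Γ := contDiff_orbitIntegrand_chart hθ hg x₀ hψ hψt
  have hÂ : ContDiff ℝ ∞ fun p : EuclideanSpace ℝ (Fin k) ↦
      (2 * π)⁻¹ * ∫ σ in (0 : ℝ)..2 * π, Γ (σ, p) := contDiff_average_param hΓs (2 * π)
  -- near `x₀` the orbit average is `Â ∘ e`
  have hev : (fun x : M ↦ (2 * π)⁻¹ * ∫ σ in (0 : ℝ)..2 * π, g (θ (Circle.exp σ) x)) =ᶠ[𝓝 x₀]
      fun x ↦ (2 * π)⁻¹ * ∫ σ in (0 : ℝ)..2 * π, Γ (σ, e x) := by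
    have h1 : ∀ᶠ x in 𝓝 x₀, ψ (e x) = 1 :=
      (continuousAt_extChartAt x₀).eventually hψ1
    filter_upwards [h1, extChartAt_source_mem_nhds (I := 𝓡 k) x₀] with x hx hxs
    simp only [hΓ, hx, one_mul, e.left_inv hxs]
  refine ContMDiffAt.congr_of_eventuallyEq ?_ hev
  exact (hÂ.contMDiff.contMDiffAt).comp x₀ (contMDiffAt_extChartAt (I := 𝓡 k) (x := x₀))

/-- **The orbitwise mean-zero primitive is smooth** (McDuff–Salamon 2017, §5.5; McLean 2012,
proof of Lemma 5.17: the correction `f''` is smooth off the divisor).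
[cite: McDuffSalamon2017, §5.5 (averaging over a circle action)] -/
theorem contMDiff_orbitMeanZero
    (hθ : ContMDiff ((𝓡 1).prod (𝓡 k)) (𝓡 k) ∞ (fun p : Circle × M ↦ θ p.1 p.2))
    (hg : ContMDiff (𝓡 k) 𝓘(ℝ, ℝ) ∞ g) :
    ContMDiff (𝓡 k) 𝓘(ℝ, ℝ) ∞ fun x : M ↦ -((2 * π)⁻¹ * ∫ τ in (0 : ℝ)..2 * π,
      ((∫ σ in (0 : ℝ)..τ, g (θ (Circle.exp σ) x)) -
        τ * ((2 * π)⁻¹ * ∫ σ in (0 : ℝ)..2 * π, g (θ (Circle.exp σ) x)))) := by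
  intro x₀
  obtain ⟨ψ, hψ, hψt, hψ1⟩ := exists_bump_chart (k := k) x₀
  set e := extChartAt (𝓡 k) x₀ with he
  set Γ : ℝ × EuclideanSpace ℝ (Fin k) → ℝ :=
    fun q ↦ ψ q.2 * g (θ (Circle.exp q.1) (e.symm q.2)) with hΓ
  have hΓs : ContDiff ℝ ∞ Γ := contDiff_orbitIntegrand_chart hθ hg x₀ hψ hψt
  have hĥ : ContDiff ℝ ∞ fun p : EuclideanSpace ℝ (Fin k) ↦ -((2 * π)⁻¹ * ∫ τ in (0 : ℝ)..2 * π,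
      ((∫ σ in (0 : ℝ)..τ, Γ (σ, p)) - τ * ((2 * π)⁻¹ * ∫ σ in (0 : ℝ)..2 * π, Γ (σ, p)))) :=
    contDiff_meanZeroValue_param hΓs (2 * π)
  have hev : (fun x : M ↦ -((2 * π)⁻¹ * ∫ τ in (0 : ℝ)..2 * π,
      ((∫ σ in (0 : ℝ)..τ, g (θ (Circle.exp σ) x)) -
        τ * ((2 * π)⁻¹ * ∫ σ in (0 : ℝ)..2 * π, g (θ (Circle.exp σ) x))))) =ᶠ[𝓝 x₀]
      fun x ↦ -((2 * π)⁻¹ * ∫ τ in (0 : ℝ)..2 * π,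
        ((∫ σ in (0 : ℝ)..τ, Γ (σ, e x)) -
          τ * ((2 * π)⁻¹ * ∫ σ in (0 : ℝ)..2 * π, Γ (σ, e x)))) := by
    have h1 : ∀ᶠ x in 𝓝 x₀, ψ (e x) = 1 :=
      (continuousAt_extChartAt x₀).eventually hψ1
    filter_upwards [h1, extChartAt_source_mem_nhds (I := 𝓡 k) x₀] with x hx hxs
    simp only [hΓ, hx, one_mul, e.left_inv hxs]
  refine ContMDiffAt.congr_of_eventuallyEq ?_ hev
  exact (hĥ.contMDiff.contMDiffAt).comp x₀ (contMDiffAt_extChartAt (I := 𝓡 k) (x := x₀))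

end Smooth

/-! ### The derivative along the fundamental vector field -/

section Fundamental

variable [IsManifold (𝓡 k) ∞ M]

/-- **`X·h = g - A`** at every point, for the fundamental vector field
`X(x) = d/dt|₀ θ(e^{it}) x` of the action: the differential of the (smooth) orbitwise mean-zero
primitive `h` at `x` evaluated on `X(x)` is `g(x) - A(x)` (chain rule on `hasDerivAt_orbitMeanZero`
at `s = 0`; McDuff–Salamon 2017, §5.5).
[cite: McDuffSalamon2017, §5.5 (averaging over a circle action)] -/
theorem mfderiv_orbitMeanZero_fundamental
    (hθ : ContMDiff ((𝓡 1).prod (𝓡 k)) (𝓡 k) ∞ (fun p : Circle × M ↦ θ p.1 p.2))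
    (hone : ∀ x, θ 1 x = x) (hmul : ∀ a b x, θ (a * b) x = θ a (θ b x))
    (hg : ContMDiff (𝓡 k) 𝓘(ℝ, ℝ) ∞ g) (x : M) :
    mfderiv (𝓡 k) 𝓘(ℝ, ℝ) (fun y : M ↦ -((2 * π)⁻¹ * ∫ τ in (0 : ℝ)..2 * π,
        ((∫ σ in (0 : ℝ)..τ, g (θ (Circle.exp σ) y)) -
          τ * ((2 * π)⁻¹ * ∫ σ in (0 : ℝ)..2 * π, g (θ (Circle.exp σ) y))))) x
      (mfderiv 𝓘(ℝ, ℝ) (𝓡 k) (fun t : ℝ ↦ θ (Circle.exp t) x) 0 (1 : ℝ)) =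
      g x - (2 * π)⁻¹ * ∫ σ in (0 : ℝ)..2 * π, g (θ (Circle.exp σ) x) := by
  set F : M → ℝ := fun y ↦ -((2 * π)⁻¹ * ∫ τ in (0 : ℝ)..2 * π,
    ((∫ σ in (0 : ℝ)..τ, g (θ (Circle.exp σ) y)) -
      τ * ((2 * π)⁻¹ * ∫ σ in (0 : ℝ)..2 * π, g (θ (Circle.exp σ) y)))) with hFdef
  set c : ℝ → M := fun t ↦ θ (Circle.exp t) x with hcdef
  have hF : ContMDiff (𝓡 k) 𝓘(ℝ, ℝ) ∞ F := contMDiff_orbitMeanZero hθ hg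
  have hc : ContMDiff 𝓘(ℝ, ℝ) (𝓡 k) ∞ c :=
    hθ.comp ((contMDiff_circleExp (m := ∞)).prodMk contMDiff_const)
  have hθc : Continuous fun p : Circle × M ↦ θ p.1 p.2 := hθ.continuous
  -- chain rule at `t = 0`
  have hkey : HasMFDerivAt 𝓘(ℝ, ℝ) 𝓘(ℝ, ℝ) (F ∘ c) 0
      ((mfderiv (𝓡 k) 𝓘(ℝ, ℝ) F (c 0)).comp (mfderiv 𝓘(ℝ, ℝ) (𝓡 k) c 0)) :=
    ((hF (c 0)).mdifferentiableAt (by simp)).hasMFDerivAt.comp 0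
      ((hc 0).mdifferentiableAt (by simp)).hasMFDerivAt
  -- the derivative along the orbit from the one-variable calculus
  have hD : HasDerivAt (F ∘ c)
      (g (θ (Circle.exp 0) x) - (2 * π)⁻¹ * ∫ σ in (0 : ℝ)..2 * π, g (θ (Circle.exp σ) x)) 0 :=
    hasDerivAt_orbitMeanZero hθc hmul hg.continuous x 0
  have hDm : HasMFDerivAt 𝓘(ℝ, ℝ) 𝓘(ℝ, ℝ) (F ∘ c) 0
      (ContinuousLinearMap.smulRight (1 : ℝ →L[ℝ] ℝ)
        (g (θ (Circle.exp 0) x) - (2 * π)⁻¹ * ∫ σ in (0 : ℝ)..2 * π, g (θ (Circle.exp σ) x))) :=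
    hasMFDerivAt_iff_hasFDerivAt.2 hD.hasFDerivAt
  have huniq := hasMFDerivAt_unique hkey hDm
  have heval : ((mfderiv (𝓡 k) 𝓘(ℝ, ℝ) F (c 0)).comp (mfderiv 𝓘(ℝ, ℝ) (𝓡 k) c 0)) (1 : ℝ) =
      g (θ (Circle.exp 0) x) - (2 * π)⁻¹ * ∫ σ in (0 : ℝ)..2 * π, g (θ (Circle.exp σ) x) := by
    rw [huniq]
    change (1 : ℝ) • (g (θ (Circle.exp 0) x) -
      (2 * π)⁻¹ * ∫ σ in (0 : ℝ)..2 * π, g (θ (Circle.exp σ) x)) = _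
    rw [one_smul]
  rw [ContinuousLinearMap.comp_apply] at heval
  have hc0 : c 0 = x := by simp only [hcdef, Circle.exp_zero, hone]
  rw [hc0] at heval
  rw [Circle.exp_zero, hone] at heval
  exact heval

end Fundamental

end Literature.Geometry.Manifold
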